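import Summits.ResolutionOfSingularities.ResolutionOfSingularities.Theorems.FrobeniusLadderFInjectiveMacaulayficationFCForallExistsDimLe2
import Mathlib.RingTheory.Localization.AsSubring
import Mathlib.RingTheory.IntegralClosure.IsIntegralClosure.Basic
import Mathlib.RingTheory.Noetherian.Basic
import HarnessLib

/-!
# The affine S₂-modification algebra along a closed set — file 1: the object, its sandwich `A ≤ A′ ≤ Ā`, its finiteness, and «iso off `V(𝔟)`»
# (crux `FInjectiveMacaulayfication` stmt-ResolutionOfSingularities-15315, chain w45a, hole #3γ, FC′ rung r2 input S-S2 `FCForallExistsDimLe2.S2Modification`;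
# res-L1-w45a-plan-1 R13.46 (1) «stub-2 := S2ModificationAffine»; construction = res-L1-w45a-stub-7's memo `D/res-D-pv-019/S2MOD-MEMO.md` §1–§3, L1 + ring half of L5;
# seat res-L1-w45a-stub-2)

[OURS · L1 W4.5a] Support file (`--supports stmt-ResolutionOfSingularities-15315 --as helper`); NOT a statement of any manuscript; no named fact;
AI-written (AI review is weaker than expert review).

THE OBJECT (memo §1, affine chart): `A` a Noetherian domain with fraction field `K`, `𝔟 = (f : f ∈ s)` the ideal of the closed set `F ∩ Spec A`,
`Ā = integralClosure A K`. The affine S₂-modification algebra along `V(𝔟)` is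
  `A′ := Ā ∩ ⋂_{f ∈ s} A[1/f]` inside `K`
(the elements of the normalisation that are sections of `𝒪_{Spec A}` on the open `Spec A ∖ V(𝔟) = ⋃ D(f)`; for an integral scheme
`Γ(⋃ D(f), 𝒪) = ⋂ A[1/f]`). This file lands the object and the cheap half of its properties:

* `awaySub A K f hf` — `A[1/f] ⊆ K` as a `Subalgebra A K` (Mathlib's `Localization.subalgebra.ofField` at `Submonoid.powers f`);
* `s2Mod A K s hs` — `A′` as a `Subalgebra A K`; `s2Mod_le_integralClosure`, `s2Mod_le_awaySub` (for `f ∈ s`), `algebraMap_mem_s2Mod`;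
* `exists_eq_mul_inv_pow` — «iso off `V(𝔟)`» at ring level: every `x ∈ A′` is `a / fⁿ` for each `f ∈ s` (so `A′[1/f] = A[1/f]`);
* `s2Mod_fg` — `A′` is a finite `A`-module as soon as `Ā` is (`A` Noetherian; E. Noether's finiteness of `Ā` for `k`-domains of finite type is
  the tree's `NoetherFiniteIntegralClosure` / `StalkNormalizationFinite`, supplied at the use site);
* `mem_s2Mod_iff` — the membership criterion spelled out; `s2Mod_eq_bot_of_isUnit` — on a chart missing `F` (a generator is a unit) `A′ = A`.

NEXT FILES (memo L2/L3, not here): compatibility with localisation `A′[1/t] = (A[1/t])′`; the Cohen–Macaulay clause at the maximal ideals of `A′`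
over `V(𝔟)` in dimension 2 by the elementary s.o.p. argument (Krull intersection for `Ā`); normality of `A′` at dimension-1 points over `V(𝔟)`;
then the scheme-level gluing (L4, stub-7) discharging `FCForallExistsDimLe2.S2Modification`. [folklore; cite: EGAIV2, 5.10.16–17]
-/

-- single-problem summit: the doubled namespace component is forced
set_option linter.dupNamespace false

noncomputable section

namespace Summit.ResolutionOfSingularities.ResolutionOfSingularities.Theorems.FInjectiveMacaulayfication.S2ModificationAffine

open Summit.ResolutionOfSingularities.ResolutionOfSingularities.Theorems.FInjectiveMacaulayfication
open nonZeroDivisors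

variable (A : Type) [CommRing A] [IsDomain A] (K : Type) [Field K] [Algebra A K] [IsFractionRing A K]

/-! ## §1 `A[1/f]` and `A′` inside `K` -/

/-- `A[1/f] ⊆ K` for `f ≠ 0`: the localisation at the powers of `f`, as an `A`-subalgebra of the fraction field. [folklore] -/
def awaySub (f : A) (hf : f ≠ 0) : Subalgebra A K :=
  Localization.subalgebra.ofField K (Submonoid.powers f) (powers_le_nonZeroDivisors_of_noZeroDivisors hf)

/-- Membership in `A[1/f]`: `x = a · (fⁿ)⁻¹`. [folklore] -/
theorem mem_awaySub_iff (f : A) (hf : f ≠ 0) (x : K) :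
    x ∈ awaySub A K f hf ↔ ∃ (a : A) (n : ℕ), x = algebraMap A K a * (algebraMap A K (f ^ n))⁻¹ := by
  unfold awaySub Localization.subalgebra.ofField
  rw [← SetLike.mem_coe, Subalgebra.coe_copy]
  simp only [Set.mem_setOf_eq, Submonoid.mem_powers_iff]
  constructor
  · rintro ⟨a, t, ⟨n, rfl⟩, rfl⟩
    exact ⟨a, n, rfl⟩
  · rintro ⟨a, n, rfl⟩
    exact ⟨a, f ^ n, ⟨n, rfl⟩, rfl⟩

/-- **The affine S₂-modification algebra along `V(s)`**: `A′ = Ā ∩ ⋂_{f ∈ s} A[1/f] ⊆ K` (`s` a finite set of NON-ZERO generators of the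
ideal of the closed set; `Ā = integralClosure A K`). [OURS · the object of memo §1; candidates not facts] -/
def s2Mod (s : Finset A) (hs : ∀ f ∈ s, f ≠ 0) : Subalgebra A K :=
  integralClosure A K ⊓ ⨅ f : s, awaySub A K f.1 (hs f.1 f.2)

/-- `A′ ≤ Ā`. [folklore] -/
theorem s2Mod_le_integralClosure (s : Finset A) (hs : ∀ f ∈ s, f ≠ 0) : s2Mod A K s hs ≤ integralClosure A K :=
  inf_le_left

/-- `A′ ≤ A[1/f]` for every `f ∈ s`. [folklore] -/
theorem s2Mod_le_awaySub (s : Finset A) (hs : ∀ f ∈ s, f ≠ 0) (f : A) (hf : f ∈ s) :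
    s2Mod A K s hs ≤ awaySub A K f (hs f hf) :=
  le_trans inf_le_right (iInf_le (fun g : s => awaySub A K g.1 (hs g.1 g.2)) ⟨f, hf⟩)

/-- `A ≤ A′` (the image of `A` in `K` lies in every `A`-subalgebra). [folklore] -/
theorem algebraMap_mem_s2Mod (s : Finset A) (hs : ∀ f ∈ s, f ≠ 0) (a : A) : algebraMap A K a ∈ s2Mod A K s hs :=
  Subalgebra.algebraMap_mem _ a

/-- Membership in `A′`: integral over `A`, and of the form `a / fⁿ` for each `f ∈ s`. [folklore] -/
theorem mem_s2Mod_iff (s : Finset A) (hs : ∀ f ∈ s, f ≠ 0) (x : K) :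
    x ∈ s2Mod A K s hs ↔ IsIntegral A x ∧ ∀ (f : A) (hf : f ∈ s), ∃ (a : A) (n : ℕ), x = algebraMap A K a * (algebraMap A K (f ^ n))⁻¹ := by
  unfold s2Mod
  rw [Algebra.mem_inf, mem_integralClosure_iff, Algebra.mem_iInf]
  refine and_congr Iff.rfl ⟨fun h f hf => (mem_awaySub_iff A K f (hs f hf) x).mp (h ⟨f, hf⟩), fun h g => ?_⟩
  exact (mem_awaySub_iff A K g.1 (hs g.1 g.2) x).mpr (h g.1 g.2)

/-! ## §2 «iso off `V(𝔟)`» and finiteness -/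

/-- **`A′` is an isomorphism off `V(𝔟)` at ring level**: after inverting any `f ∈ s`, every element of `A′` already lies in `A[1/f]` —
`x = a / fⁿ`. (So `A′[1/f] = A[1/f]`; the stalk form «`g` is a stalk isomorphism off `F`» is memo §2 (a).) [folklore] -/
theorem exists_eq_mul_inv_pow (s : Finset A) (hs : ∀ f ∈ s, f ≠ 0) {x : K} (hx : x ∈ s2Mod A K s hs) (f : A) (hf : f ∈ s) :
    ∃ (a : A) (n : ℕ), x = algebraMap A K a * (algebraMap A K (f ^ n))⁻¹ :=
  ((mem_s2Mod_iff A K s hs x).mp hx).2 f hf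

/-- **`A′` is a finite `A`-module** when the integral closure is (`A` Noetherian): a submodule of a finitely generated module over a
Noetherian ring. (For a domain of finite type over a field the hypothesis is E. Noether's theorem, in the tree as
`NoetherFiniteIntegralClosure` / `StalkNormalizationFinite`.) [folklore] -/
theorem s2Mod_fg [IsNoetherianRing A] (s : Finset A) (hs : ∀ f ∈ s, f ≠ 0)
    (hfin : (Subalgebra.toSubmodule (integralClosure A K)).FG) :
    (Subalgebra.toSubmodule (s2Mod A K s hs)).FG :=
  Submodule.FG.of_le hfin (Subalgebra.toSubmodule.le_iff_le.mpr (s2Mod_le_integralClosure A K s hs))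

/-- `A′` is Noetherian as a ring when it is a finite `A`-module over the Noetherian ring `A`. [folklore] -/
theorem isNoetherianRing_s2Mod [IsNoetherianRing A] (s : Finset A) (hs : ∀ f ∈ s, f ≠ 0)
    (hfin : (Subalgebra.toSubmodule (integralClosure A K)).FG) : IsNoetherianRing (s2Mod A K s hs) := by
  haveI : Module.Finite A (s2Mod A K s hs) := Module.Finite.of_fg (s2Mod_fg A K s hs hfin)
  exact IsNoetherianRing.of_finite A (s2Mod A K s hs)

/-- `A′` is a domain (a subring of the field `K`). [folklore] -/
theorem isDomain_s2Mod (s : Finset A) (hs : ∀ f ∈ s, f ≠ 0) : IsDomain (s2Mod A K s hs) :=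
  inferInstance

/-! ## §3 Charts missing `F`: the modification is trivial -/

/-- If `f` is a unit of `A`, then `A[1/f] = A` inside `K` (the bottom subalgebra). [folklore] -/
theorem awaySub_eq_bot_of_isUnit (f : A) (hf : f ≠ 0) (hu : IsUnit f) : awaySub A K f hf = ⊥ := by
  refine le_antisymm (fun x hx => ?_) bot_le
  obtain ⟨a, n, rfl⟩ := (mem_awaySub_iff A K f hf x).mp hx
  obtain ⟨v, hv⟩ := (hu.pow n).exists_left_inv
  refine Algebra.mem_bot.mpr ⟨a * v, ?_⟩
  have hfn : algebraMap A K (f ^ n) ≠ 0 :=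
    fun h => pow_ne_zero n hf ((injective_iff_map_eq_zero (algebraMap A K)).mp (IsFractionRing.injective A K) _ h)
  rw [map_mul, eq_mul_inv_iff_mul_eq₀ hfn, mul_assoc, ← map_mul, hv, map_one, mul_one]

/-- **On a chart missing `F` the S₂-modification algebra is `A` itself**: if some generator `f ∈ s` is a unit (i.e. `V(𝔟) ∩ Spec A = ∅`),
then `A′ = A` (the bottom subalgebra of `K`). [folklore] -/
theorem s2Mod_eq_bot_of_isUnit (s : Finset A) (hs : ∀ f ∈ s, f ≠ 0) (f : A) (hf : f ∈ s) (hu : IsUnit f) :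
    s2Mod A K s hs = ⊥ :=
  le_antisymm (le_trans (s2Mod_le_awaySub A K s hs f hf) (awaySub_eq_bot_of_isUnit A K f (hs f hf) hu).le) bot_le

end Summit.ResolutionOfSingularities.ResolutionOfSingularities.Theorems.FInjectiveMacaulayfication.S2ModificationAffine

end
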